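import Summits.BirchSwinnertonDyer.BirchSwinnertonDyer.Theorems.QuadraticBranchSignedControlPlusEtaCMRankZeroOfUpper
import Summits.BirchSwinnertonDyer.Rank1Residual.Additive.TameBranchBudgetSqueeze
import Literature.NumberTheory.EllipticCurves.GreenbergVatsal2000.CongruentCurves
import HarnessLib

/-!
# Route `QuadraticBranchSignedControl` (rung K8, cell `bsd-potss`), residual crux
# `PlusEtaMainConjectureNonsurj` (stmt-BirchSwinnertonDyer-19606): the `μ`-SATURATION AT `η` — the
# integral Kato-side inclusion `(L_p⁺(V,η,X)) ⊆ Char(X⁺(V/K_∞)^η)` (stubs `stub_etaMC_nonCM_upper`,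
# `stub_etaMC_cm_upper`: the literature gap of the non-onto rows) FOLLOWS from `μ(X⁺(V/K_∞)^η) = 0`,
# with NO hypothesis on the image of `ρ_{V,p}` (seat `bsd-potss-k8eta-c2` g2)

WHAT. On the rows of crux 19606 (good supersingular `a_p = 0` twists `V`, `p ≥ 5`, whose `p`-adic
tower is NOT onto: CM, or image `C_ns⁺(p)` exactly — k8eta-c2 g0, p448914) Kobayashi's Thm. 4.1 at `η`
gives only `Char(X⁺(V/K_∞)^η) ⊇ (pⁿ·L_p⁺(V,η,X))`; the INTEGRAL inclusion (`n = 0`) is what Kato's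
Thm. 12.5 (4) supplies at `SL₂(ℤ_p) ⊆ Im ρ` only (Wuthrich 2014 pp. 398–399: the normaliser-of-Cartan
curves are exactly where this fails in print). Seat ctrl g4 (p464359, p467934) reduced 19606 on its
analytic-rank-`0` rows to «that integral inclusion + (lower `BSD_p(W)` per row | nothing on CM rows,
bsd.S28)». THIS FILE removes the image from the remaining binder: the RATIONAL clause
`∃ n, pⁿ·Lη ∈ Char` of Thm. 4.1 at `η` (tree fact `Kobayashi2003.thm41_plusEtaCharIdeal_dvd`, first
display, NO image hypothesis) is already the integral inclusion as soon as a characteristic generator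
`g` of `X⁺(V/K_∞)^η` has UNIT CONTENT (`p ∤ g` in `Λ`, i.e. `μ(X⁺(V/K_∞)^η) = 0`) — Gauss' lemma for
the prime element `p ∈ Λ = ℤ_p⟦T⟧` (`Additive.dvd_of_dvd_C_pow_mul_of_hasUnitContent`). The `η`-twin of
cell bsd-ssimc's `signedUpper_dvd_of_hasUnitContent` (crux 19002, the trivial component).

* §1 `etaUpperIntegral_of_hasUnitContent` — at `(V,p)`: Thm. 2.2 / 4.1 at `η` (named facts) +
  `μ(X⁺(V/K_∞)^η) = 0` for every `η`-datum (displayed) ⟹ the conclusion of `stub_etaMC_nonCM_upper` /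
  `stub_etaMC_cm_upper` at `(V,p)` (`EtaUpperIntegralAt V p`, verbatim).
* §2 composed with ctrl g4's converse roads: `quadraticBranchPlusEtaMainConjectureAt_of_hasUnitContent_of_missingLowerBoundAt`
  (rank-`0` pair: `μ = 0` + lower `BSD_p(W)` ⟹ (C1⁺_η)(V)) and `…_of_hasUnitContent_of_hasCM_rankZero`
  (CM rank-`0` pair: `μ = 0` ALONE ⟹ (C1⁺_η)(V), the lower half being Burungale–Flach bsd.S28); the
  stub-shaped ∀-forms `etaMC_nonsurj_rankZeroRows_of_mu_eq_zero_of_lowerBSD`,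
  `etaMC_cm_rankZeroRows_of_mu_eq_zero`.
So on its rank-`0` rows crux 19606 ⟸ «`μ(X⁺(V/K_∞)^η) = 0` + (L₀(W) | nothing on CM rows)» — the
`μ = 0` conjecture for the `η`-signed Selmer group (the supersingular analogue of Greenberg's
`μ`-conjecture; for the trivial component and a CM partner it is B. D. Kim 2009 Cor. 2.13 + Pollack–Rubin,
bsd-ssimc `…SmallImageMuTransferCM`) REPLACES the integral Euler-system bound at small image. The
companion files `…PlusEtaBottomLayer{Finite,Trivial}.lean` bound the `μ`-ambiguity by the bottom
layer and kill it on the unit rows.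

HONEST FRAMING (cell `bsd-potss`, run/shared/lean/pub/bsd-potss/; FULL-BSD rank ≤ 1 programme,
tranche 1b, HUMAN RULING D-0036/D-0074): BOOKKEEPING THEOREMS ONLY — no definition, no named
Literature fact minted, no Summits-side `def … : Prop`, no `sorry`, axioms standard. CONDITIONAL on:
`μ(X⁺(V/K_∞)^η) = 0` (DISPLAYED binder — open in general; no source in print at `η` off the onto
locus), Kobayashi 2003 Thm. 2.2 / Thm. 4.1 (rational clause) at `η`, Kitajima–Otsuki 2018 Thm. 1.3 at
`η`, Poitou–Tate, modularity, GZK, Burungale–Flach 2024 (bsd.S28) — named facts, hypothesis position.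
No stub of 19606 is proved by name; the crux stays OPEN; rank-`1` rows untouched; nothing is booked;
no label / mark / count moves; `BSD(W,p)` is claimed for no pair. `--supports stmt-BirchSwinnertonDyer-19606`.

References: [Kobayashi2003] Thm. 2.2 (p. 5), §4 Even main conjecture + Thm. 4.1 first display (p. 8);
[Kato2004Asterisque] Thm. 12.5 (4); [Wuthrich2014] remark after Cor. 19 (pp. 398–399);
[GreenbergVatsal2000] p. 2 (2); [Washington1997] §7.1, §13.1; [BDKim2009] Cor. 2.13 (the trivial
component; shape only); [BurungaleFlach2024] Thm. 1.1 + Cor. 2; [Miller2011LMS] Def. 1.1.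
-/

set_option autoImplicit false
set_option linter.dupNamespace false

noncomputable section

open scoped Classical

open CongruenceSubgroup Field Function NumberField IsDedekindDomain WeierstrassCurve
open Literature.NumberTheory.EllipticCurves
open Literature.NumberTheory.EllipticCurves.ModularForms
open Literature.NumberTheory.EllipticCurves.Rank1Residual
open Literature.NumberTheory.EllipticCurves.Rank1Residual.Typed
open Literature.NumberTheory.GaloisRepresentations
open Literature.NumberTheory.GaloisCohomology
open Literature.NumberTheory.EllipticCurves.IwasawaAlgebra
open Literature.NumberTheory.EllipticCurves.IwasawaDual ZpExtension
open Literature.NumberTheory.EllipticCurves.GreenbergVatsal2000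
open Summit.BirchSwinnertonDyer.Rank1Residual.X11b.Levels
open Summit.BirchSwinnertonDyer.Rank1Residual.X11b
open Summit.BirchSwinnertonDyer.Rank1Residual.Additive
open Summit.BirchSwinnertonDyer.Rank1Residual.Additive.SignedTwist
open scoped ContRepresentation
open Summit.BirchSwinnertonDyer.Rank1Residual.AdditivePotMult

namespace Summit.BirchSwinnertonDyer.BirchSwinnertonDyer.Theorems

namespace EtaMuSaturation

/-! ## §1 The integral upper inclusion at `η` from `μ(X⁺(V/K_∞)^η) = 0` — image-free -/

section Upper

variable (V : WeierstrassCurve ℚ) [V.IsElliptic] [V.IsGloballyMinimal] (p : ℕ) [hp : Fact p.Prime]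

/-- **The integral Kato-side inclusion at `η` with NO image hypothesis, given `μ(X⁺(V/K_∞)^η) = 0`.**
For `V` globally minimal: granted Kobayashi's Thm. 2.2 at `η` (`h22`) and the RATIONAL clause of
Thm. 4.1 at `η` (`h41`: `∃ n, pⁿ·Lη ∈ Char(X⁺(V/K_∞)^η)`, valid for ANY Galois image), if every
`η`-signed plus dual datum has a characteristic generator of UNIT CONTENT (`hμ`: `p ∤ g` in `Λ`,
Greenberg–Vatsal's reading of `μ = 0`), then `(Lη) ⊆ Char(D.X)` on the binders of (C1⁺_η) — verbatim
the conclusion `EtaUpperIntegralAt V p` of the stubs `stub_etaMC_nonCM_upper` / `stub_etaMC_cm_upper`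
of crux 19606 at `(V,p)`: `g ∣ pⁿ·Lη` and `p ∤ g` give `g ∣ Lη` by Gauss' lemma for the prime `p ∈ Λ`
(`Additive.dvd_of_dvd_C_pow_mul_of_hasUnitContent`). CONDITIONAL on the displayed binders.
[cite: Kobayashi2003, Thm. 4.1 first display (p. 8), Thm. 2.2 (p. 5)] [cite: GreenbergVatsal2000, p. 2 (2)]
[cite: Washington1997, §7.1 and §13.1] -/
theorem etaUpperIntegral_of_hasUnitContent
    (h22 : Kobayashi2003.thm22_etaSignedSelmerDual_finite_torsion)
    (h41 : Kobayashi2003.thm41_plusEtaCharIdeal_dvd)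
    (hμ : ∀ (K₀ : Type) [Field K₀] [NumberField K₀] [IsCyclotomicExtension {p} ℚ K₀]
        [(galRange (K := ℚ) K₀).Normal] (ηq : absoluteGaloisGroup ℚ →* ℤˣ),
        (∀ σ ∈ galRange (K := ℚ) K₀, ηq σ = 1) → ηq ≠ 1 →
      ∀ (κ : ZpExtension ℚ p) (γ : absoluteGaloisGroup ℚ),
        κ.IsCyclotomic → κ.IsTopGenerator γ → γ ∈ galRange (K := ℚ) K₀ →
      ∀ (D : EtaSignedSelmerDualData V κ K₀ ℚ_[p] ηq γ 1) (g : IwasawaAlgebra p),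
        D.charIdeal = Ideal.span {g} → HasUnitContent g) :
    ∀ (K₀ : Type) [Field K₀] [NumberField K₀] [IsCyclotomicExtension {p} ℚ K₀]
        [(galRange (K := ℚ) K₀).Normal] (ηq : absoluteGaloisGroup ℚ →* ℤˣ),
        (∀ σ ∈ galRange (K := ℚ) K₀, ηq σ = 1) → ηq ≠ 1 →
      ∀ {N : ℕ} [NeZero N] {f : CuspForm (Gamma0 N) 2},
        p ≠ 2 → V.HasGoodReductionAtPrime p → V.frobeniusTrace p = 0 → IsNewformOf V f →
      ∀ (ϖ : ℚ), (if Even (p / 2) then (ϖ : ℝ) * V.realPeriodRat = plusPeriod f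
          else (ϖ : ℝ) * V.imaginaryPeriodRat = minusPeriod f) →
      ∀ (Lη : IwasawaAlgebra p), IsQuadraticBranchPlusLFunction f p ϖ Lη →
      ∀ (κ : ZpExtension ℚ p) (γ : absoluteGaloisGroup ℚ),
        κ.IsCyclotomic → κ.IsTopGenerator γ → γ ∈ galRange (K := ℚ) K₀ → IsCyclotomicVariable p γ →
      ∀ (D : EtaSignedSelmerDualData V κ K₀ ℚ_[p] ηq γ 1), Ideal.span {Lη} ≤ D.charIdeal := by
  intro K₀ _ _ _ _ ηq hηK hη1 N _ f hp2 hgood hap hf ϖ hϖ Lη hL κ γ hκ hγ hγK hγc D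
  -- Thm. 4.1 at `η`, rational clause: `pⁿ·Lη ∈ Char`
  obtain ⟨⟨n, hn⟩, -⟩ := EtaSignedSelmerDualData.thm41_plus_of_facts h22 h41 hηK hη1 hp2 hgood hap hf
    ϖ hϖ Lη hL hκ hγ hγK hγc D
  -- a generator of `Char(X⁺(V/K_∞)^η)` (`Λ` a UFD), of unit content by `hμ`
  haveI : D.charIdeal.IsPrincipal := charIdeal_isPrincipal_holds p D.X
  obtain ⟨g, hg⟩ := Submodule.IsPrincipal.principal D.charIdeal
  have hg' : D.charIdeal = Ideal.span {g} := hg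
  have hu : HasUnitContent g := hμ K₀ ηq hηK hη1 κ γ hκ hγ hγK D g hg'
  -- `g ∣ pⁿ·Lη`, hence `g ∣ Lη` (Gauss)
  rw [hg', Ideal.mem_span_singleton] at hn
  have hC : ((p : IwasawaAlgebra p) ^ n : IwasawaAlgebra p) = PowerSeries.C ((p : ℤ_[p]) ^ n) := by
    rw [map_pow, map_natCast]
  rw [hC] at hn
  have hdvd : g ∣ Lη := dvd_of_dvd_C_pow_mul_of_hasUnitContent hu n hn
  rw [hg']
  exact Ideal.span_singleton_le_span_singleton.mpr hdvd

end Upper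

/-! ## §2 Composed with the converse roads: on rank-`0` rows 19606 ⟸ `μ = 0` (+ L₀ off the CM rows) -/

section RankZero

variable (W : WeierstrassCurve ℚ) [W.IsElliptic] [W.IsGloballyMinimal] (p : ℕ) [hp : Fact p.Prime]

/-- **(C1⁺_η)(V) at a Gss2 pair of analytic rank `0` from `μ(X⁺(V/K_∞)^η) = 0` and the LOWER half of
`BSD_p(W)` — no image hypothesis.** `W` globally minimal, `p ≥ 5`, `V` a globally minimal model of
`W^{(p*)}` good at `p` with `a_p(V) = 0`, `L(W,1) ≠ 0`, `Typed.MissingLowerBoundAt W p`; `μ = 0` for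
every `η`-datum (`hμ`, displayed); named facts `hPT`, `hmod`, `hGZK`, `h22`, `h41`, `hKO`. §1 supplies
the binder `hup` of ctrl g4's `ConverseControl.quadraticBranchPlusEtaMainConjectureAt_of_etaUpperIntegral_of_missingLowerBoundAt`.
CONDITIONAL; nothing booked. [cite: Kobayashi2003, §4 Even main conjecture and Thm. 4.1 (p. 8)]
[cite: GreenbergVatsal2000, p. 2 (2)] [cite: Miller2011LMS, Def. 1.1] -/
theorem quadraticBranchPlusEtaMainConjectureAt_of_hasUnitContent_of_missingLowerBoundAt
    (hPT : poitouTate_selmerStructure_duality_real ℚ) (hmod : hasEntireLFunction_rat)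
    (hGZK : rank_eq_analyticRank_of_analyticRank_le_one)
    (h22 : Kobayashi2003.thm22_etaSignedSelmerDual_finite_torsion)
    (h41 : Kobayashi2003.thm41_plusEtaCharIdeal_dvd)
    (hKO : KitajimaOtsuki2018.mainThm13_etaSignedSelmerDual_noFiniteSubmodule)
    (V : WeierstrassCurve ℚ) [V.IsElliptic] [V.IsGloballyMinimal] (C : VariableChange ℚ)
    (hp5 : 5 ≤ p) (hCV : C • W.quadraticTwist ((-1) ^ (p / 2) * p) = V)
    (hgood : V.HasGoodReductionAtPrime p) (hap : V.frobeniusTrace p = 0)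
    (hμ : ∀ (K₀ : Type) [Field K₀] [NumberField K₀] [IsCyclotomicExtension {p} ℚ K₀]
        [(galRange (K := ℚ) K₀).Normal] (ηq : absoluteGaloisGroup ℚ →* ℤˣ),
        (∀ σ ∈ galRange (K := ℚ) K₀, ηq σ = 1) → ηq ≠ 1 →
      ∀ (κ : ZpExtension ℚ p) (γ : absoluteGaloisGroup ℚ),
        κ.IsCyclotomic → κ.IsTopGenerator γ → γ ∈ galRange (K := ℚ) K₀ →
      ∀ (D : EtaSignedSelmerDualData V κ K₀ ℚ_[p] ηq γ 1) (g : IwasawaAlgebra p),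
        D.charIdeal = Ideal.span {g} → HasUnitContent g)
    (hLW : W.entireLFunction 1 ≠ 0) (hlow : MissingLowerBoundAt W p) :
    QuadraticBranchPlusEtaMainConjectureAt V p :=
  ConverseControl.quadraticBranchPlusEtaMainConjectureAt_of_etaUpperIntegral_of_missingLowerBoundAt W p
    hPT hmod hGZK h22 hKO V C hp5 hCV hgood hap (etaUpperIntegral_of_hasUnitContent V p h22 h41 hμ) hLW hlow

/-- **(C1⁺_η)(V) at a CM Gss2 pair of analytic rank `0` from `μ(X⁺(V/K_∞)^η) = 0` ALONE** (the lower
half of `BSD_p(W)` of the CM partner `W` is bsd.S28, Burungale–Flach 2024, via ctrl g4's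
`…_of_etaUpperIntegral_of_hasCM_rankZero`): `V` CM, `p ≥ 5`, good with `a_p(V) = 0`,
`C • W^{(p*)} = V`, `L(W,1) ≠ 0`; named facts `hPT`, `hmod`, `hGZK`, `h22`, `h41`, `hKO`, `hS28`.
So on the CM rank-`0` rows of crux 19606 the ONLY non-published input left is the `μ = 0` statement
for `X⁺(V/K_∞)^η`. CONDITIONAL; nothing booked. [cite: Kobayashi2003, §4 Even main conjecture and Thm. 4.1 (p. 8)]
[cite: BurungaleFlach2024, Thm 1.1 and Cor. 2] [cite: PollackRubin2004, Theorem and remark p. 448] -/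
theorem quadraticBranchPlusEtaMainConjectureAt_of_hasUnitContent_of_hasCM_rankZero
    (hPT : poitouTate_selmerStructure_duality_real ℚ) (hmod : hasEntireLFunction_rat)
    (hGZK : rank_eq_analyticRank_of_analyticRank_le_one)
    (h22 : Kobayashi2003.thm22_etaSignedSelmerDual_finite_torsion)
    (h41 : Kobayashi2003.thm41_plusEtaCharIdeal_dvd)
    (hKO : KitajimaOtsuki2018.mainThm13_etaSignedSelmerDual_noFiniteSubmodule)
    (hS28 : bsdTriple_of_hasCM_of_L_one_ne_zero)
    (V : WeierstrassCurve ℚ) [V.IsElliptic] [V.IsGloballyMinimal] (C : VariableChange ℚ)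
    (hp5 : 5 ≤ p) (hCV : C • W.quadraticTwist ((-1) ^ (p / 2) * p) = V)
    (hgood : V.HasGoodReductionAtPrime p) (hap : V.frobeniusTrace p = 0) (hCM : V.HasCM)
    (hμ : ∀ (K₀ : Type) [Field K₀] [NumberField K₀] [IsCyclotomicExtension {p} ℚ K₀]
        [(galRange (K := ℚ) K₀).Normal] (ηq : absoluteGaloisGroup ℚ →* ℤˣ),
        (∀ σ ∈ galRange (K := ℚ) K₀, ηq σ = 1) → ηq ≠ 1 →
      ∀ (κ : ZpExtension ℚ p) (γ : absoluteGaloisGroup ℚ),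
        κ.IsCyclotomic → κ.IsTopGenerator γ → γ ∈ galRange (K := ℚ) K₀ →
      ∀ (D : EtaSignedSelmerDualData V κ K₀ ℚ_[p] ηq γ 1) (g : IwasawaAlgebra p),
        D.charIdeal = Ideal.span {g} → HasUnitContent g)
    (hLW : W.entireLFunction 1 ≠ 0) :
    QuadraticBranchPlusEtaMainConjectureAt V p :=
  ConverseControl.quadraticBranchPlusEtaMainConjectureAt_of_etaUpperIntegral_of_hasCM_rankZero W p hPT hmod
    hGZK h22 hKO hS28 V C hp5 hCV hgood hap hCM (etaUpperIntegral_of_hasUnitContent V p h22 h41 hμ) hLW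

end RankZero

/-! ## §3 The stub-shaped ∀-forms on 19606's binders -/

/-- **19606 on its NON-CM rank-`0` rows ⟸ `μ(X⁺(V/K_∞)^η) = 0` + one lower-`BSD_p` witness per row**
(the binders of `stub_etaMC_nonCM_upper` / `_lower`: `p ≥ 5`, `V` good with `a_p = 0`, tower NOT onto,
`V` non-CM — the last two displayed and idle — with the partner `W`, `C • W^{(p*)} = V`, `L(W,1) ≠ 0`,
`Typed.MissingLowerBoundAt W p`): ctrl g4's `etaMC_nonsurj_rankZeroRows_of_upper_of_lowerBSD` with its
binder `EtaUpperIntegralAt V p` (the literature gap) REPLACED by the `μ = 0` statement through §1.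
CONDITIONAL on the named facts `hPT`, `hmod`, `hGZK`, `h22`, `h41`, `hKO`; no stub proved by name.
[cite: Kobayashi2003, §4 and Thm. 4.1 (p. 8)] [cite: Wuthrich2014, remark after Cor. 19 (pp. 398–399)]
[cite: GreenbergVatsal2000, p. 2 (2)] -/
theorem etaMC_nonsurj_rankZeroRows_of_mu_eq_zero_of_lowerBSD
    (hPT : poitouTate_selmerStructure_duality_real ℚ) (hmod : hasEntireLFunction_rat)
    (hGZK : rank_eq_analyticRank_of_analyticRank_le_one)
    (h22 : Kobayashi2003.thm22_etaSignedSelmerDual_finite_torsion)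
    (h41 : Kobayashi2003.thm41_plusEtaCharIdeal_dvd)
    (hKO : KitajimaOtsuki2018.mainThm13_etaSignedSelmerDual_noFiniteSubmodule) :
    ∀ (V : WeierstrassCurve ℚ) [V.IsElliptic] [V.IsGloballyMinimal] (p : ℕ) [Fact p.Prime],
      5 ≤ p → V.HasGoodReductionAtPrime p → V.frobeniusTrace p = 0 →
      ¬ (∀ m : ℕ, V.HasSurjectiveModNGaloisRep (p ^ m : ℕ)) → ¬ V.HasCM →
      (∀ (K₀ : Type) [Field K₀] [NumberField K₀] [IsCyclotomicExtension {p} ℚ K₀]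
          [(galRange (K := ℚ) K₀).Normal] (ηq : absoluteGaloisGroup ℚ →* ℤˣ),
          (∀ σ ∈ galRange (K := ℚ) K₀, ηq σ = 1) → ηq ≠ 1 →
        ∀ (κ : ZpExtension ℚ p) (γ : absoluteGaloisGroup ℚ),
          κ.IsCyclotomic → κ.IsTopGenerator γ → γ ∈ galRange (K := ℚ) K₀ →
        ∀ (D : EtaSignedSelmerDualData V κ K₀ ℚ_[p] ηq γ 1) (g : IwasawaAlgebra p),
          D.charIdeal = Ideal.span {g} → HasUnitContent g) →
      ∀ (W : WeierstrassCurve ℚ) [W.IsElliptic] [W.IsGloballyMinimal] (C : VariableChange ℚ),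
        C • W.quadraticTwist ((-1) ^ (p / 2) * p) = V → W.entireLFunction 1 ≠ 0 →
        MissingLowerBoundAt W p → QuadraticBranchPlusEtaMainConjectureAt V p := by
  intro V _ _ p _ hp5 hgood hap _ _ hμ W _ _ C hCV hLW hlow
  exact quadraticBranchPlusEtaMainConjectureAt_of_hasUnitContent_of_missingLowerBoundAt W p hPT hmod hGZK
    h22 h41 hKO V C hp5 hCV hgood hap hμ hLW hlow

/-- **19606 on its CM rank-`0` rows ⟸ `μ(X⁺(V/K_∞)^η) = 0`, nothing else per row** (the binders of
`stub_etaMC_cm` / `stub_etaMC_cm_upper`: `p ≥ 5`, `V` good with `a_p = 0`, tower NOT onto —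
displayed, idle — `V` CM, with the partner `W`, `C • W^{(p*)} = V`, `L(W,1) ≠ 0` as the rank-`0`
condition): ctrl g4's `etaMC_cm_rankZeroRows_of_upper` with `EtaUpperIntegralAt V p` REPLACED by
`μ = 0`. CONDITIONAL on `hPT`, `hmod`, `hGZK`, `h22`, `h41`, `hKO`, `hS28`; no stub proved by name.
[cite: Kobayashi2003, §4 and Thm. 4.1 (p. 8)] [cite: BurungaleFlach2024, Thm 1.1 and Cor. 2]
[cite: PollackRubin2004, Theorem and remark p. 448] -/
theorem etaMC_cm_rankZeroRows_of_mu_eq_zero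
    (hPT : poitouTate_selmerStructure_duality_real ℚ) (hmod : hasEntireLFunction_rat)
    (hGZK : rank_eq_analyticRank_of_analyticRank_le_one)
    (h22 : Kobayashi2003.thm22_etaSignedSelmerDual_finite_torsion)
    (h41 : Kobayashi2003.thm41_plusEtaCharIdeal_dvd)
    (hKO : KitajimaOtsuki2018.mainThm13_etaSignedSelmerDual_noFiniteSubmodule)
    (hS28 : bsdTriple_of_hasCM_of_L_one_ne_zero) :
    ∀ (V : WeierstrassCurve ℚ) [V.IsElliptic] [V.IsGloballyMinimal] (p : ℕ) [Fact p.Prime],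
      5 ≤ p → V.HasGoodReductionAtPrime p → V.frobeniusTrace p = 0 →
      ¬ (∀ m : ℕ, V.HasSurjectiveModNGaloisRep (p ^ m : ℕ)) → V.HasCM →
      (∀ (K₀ : Type) [Field K₀] [NumberField K₀] [IsCyclotomicExtension {p} ℚ K₀]
          [(galRange (K := ℚ) K₀).Normal] (ηq : absoluteGaloisGroup ℚ →* ℤˣ),
          (∀ σ ∈ galRange (K := ℚ) K₀, ηq σ = 1) → ηq ≠ 1 →
        ∀ (κ : ZpExtension ℚ p) (γ : absoluteGaloisGroup ℚ),
          κ.IsCyclotomic → κ.IsTopGenerator γ → γ ∈ galRange (K := ℚ) K₀ →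
        ∀ (D : EtaSignedSelmerDualData V κ K₀ ℚ_[p] ηq γ 1) (g : IwasawaAlgebra p),
          D.charIdeal = Ideal.span {g} → HasUnitContent g) →
      ∀ (W : WeierstrassCurve ℚ) [W.IsElliptic] [W.IsGloballyMinimal] (C : VariableChange ℚ),
        C • W.quadraticTwist ((-1) ^ (p / 2) * p) = V → W.entireLFunction 1 ≠ 0 →
        QuadraticBranchPlusEtaMainConjectureAt V p := by
  intro V _ _ p _ hp5 hgood hap _ hCM hμ W _ _ C hCV hLW
  exact quadraticBranchPlusEtaMainConjectureAt_of_hasUnitContent_of_hasCM_rankZero W p hPT hmod hGZK h22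
    h41 hKO hS28 V C hp5 hCV hgood hap hCM hμ hLW

end EtaMuSaturation

end Summit.BirchSwinnertonDyer.BirchSwinnertonDyer.Theorems

end
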